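import Summits.CriticalPhenomena.PercolationContinuityZ3.Theorems.FK.Transplant.FHSlabPercolation
import Summits.CriticalPhenomena.PercolationContinuityZ3.Theorems.FK.Transplant.KNFreeSeedsFkLaw
import HarnessLib

/-!
# FRONTIER TRANSPLANT, binder 2 (TP_FK) — T4-SLAB (L1): lane infrastructure I — region monotonicity of free laws, the price of
# explicit edges, placed slab copies inside a box (ONE PLATE STEP), composition, straight lanes (`fkLaw`, `q ≥ 1`)

Support file (`--supports stmt-CriticalPhenomena-4575`, helper) of the FRONTIER TRANSPLANT sub-cell (`fk-continuity/transplant/`,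
seat `prim-bschramm-fkt-p1`); builds on p205010 (kernel theorem, internal audit signed; external expert review pending).
0 definitions · 0 named facts · 0 sorries · standard axioms. File 3/18 of the bytes-first package (R60 (3)(β)) of the
UNFUNDED memo row `T4-SLAB [g122, R60]` (re-described R62 (E)); proposable only on a coordinator ruling.
Registered R63 (cell INBOX l.4709, 2026-08-23); registry row T4s; lead label T4s-03 (fkt-lead L22, l.4677).

HONEST FRAMING (page 1, cell rule). The transplant's theorem of record `ufsc0_of_freeBoundaryHypothesis_r3` (p248245) is
CONDITIONAL on FH AND on TP_FK = `KNFreeTargetHittable d q p`, both OPEN at the same `p` for `q > 1` near `p_c(q)` (⇔ GRC Conj.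
(5.103) via K1; barrier note `Literature.Barriers.CriticalPhenomena.SamePFreeBoundaryCriteria`, FBN-01, cited first); the
transplant is a typed reduction, not a proof of FK continuity. THIS FILE is unconditional law-abstract lane infrastructure for the slab Step IV (`q ≥ 1`, any finite piece, any
weighting): region monotonicity of free laws ((3.22) + Λ-independence), the price `p̃ = p/(p+q(1-p))` of explicit
edges (insertion tolerance), placed copies of the slab `S(L,N)` inside an arbitrary box and ONE PLATE STEP between two
near points (from the two-point bound `β` of `Π(p, L)` in placed copies, a hypothesis here), composition of
connections (FKG, Thm. (3.8)), straight lanes of `k` plate steps along one coordinate (`≥ β^k`). It proves nothing about either binder and says nothing at `p ↓ p_c(q)`; NOT `_r4`; `_r3` « 2 / 0 ☑ », n_open = 2,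
BINDER-OWNERS, FO-19 NO-GO unchanged.

Declarations: `fkLaw_restrW_real_mono_region`, `pow_mul_real_le_fkLaw_real_subset_inter`,
`image_signedPerm_add_subset_Icc`, `exists_perm_long_eq`, `exists_image_fkSlab_subset_Icc_pair`,
`le_fkLaw_Icc_real_openConnIn_of_near`, `mul_le_fkLaw_real_openConnIn_trans`, `pow_le_fkLaw_Icc_real_openConnIn_line`.

References: G. Grimmett, *The Random-Cluster Model*, Springer 2006, Thm. (3.1) eq. (3.4), Thm. (3.7), Thm. (3.8), Thm. (3.21)
eq. (3.22), Lemma (4.13), §5.7 [Grimmett2006]; G. Kozma, S. Nitzan, arXiv:2401.12397 (2024), §4 Lemma 10 Step IV (pp. 19–21) [KozmaNitzan2024].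
-/

noncomputable section

namespace Summit.CriticalPhenomena.PercolationContinuityZ3.Theorems.FK

open MeasureTheory
open scoped ENNReal Classical
open Literature.Probability.Percolation Literature.Probability.LatticeModels SimpleGraph
open Literature.Probability.Percolation.GadgetSystem Literature.Probability.Percolation.KozmaNitzan Transplant
open Literature.Barriers.CriticalPhenomena

variable {d : ℕ}

/-- **The free law of a sub-region is dominated by the free law of a super-region** on increasing events
(`q ≥ 1`; (3.22) + Λ-independence): for `T ⊆ P`, `φ^free_T(A) ≤ φ^free_P(A)`. [cite: Grimmett2006, Thm. (3.21) eq. (3.22); Lemma (4.13) (p. 71)] -/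
theorem fkLaw_restrW_real_mono_region {q : ℝ} (hq : 1 ≤ q) (w : Sym2 (Site d) → unitInterval)
    {T P : Finset (Site d)} (hTP : T ⊆ P) {A : Set (BondConfig (Site d))} (hA : IsUpperSet A)
    (hAm : MeasurableSet A) :
    (fkLaw T (restrW (↑T : Set (Site d)) w) q).real A ≤ (fkLaw P (restrW (↑P : Set (Site d)) w) q).real A := by
  have hq0 : 0 < q := one_pos.trans_le hq
  rw [← fkLaw_eq_of_subset hTP (finSupp_restrW T w) hq0]
  exact fkLaw_real_mono_weights' P (fun e => restrW_le_restrW_of_subset w (Finset.coe_subset.2 hTP) e) hq hA hAm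

/-- **Explicit edges cost a factor `p̃` each** (insertion tolerance, `q ≥ 1`): for a finite set `F` of pairs of `Λ`
carrying weight `p` and an INCREASING measurable event `C`, `p̃^{#F} · φ(C) ≤ φ({F open} ∩ C)`, `p̃ = p/(p+q(1-p))`.
The sheet crossings / column ends of a lane. [cite: Grimmett2006, Thm. (3.1) eq. (3.4) (finite energy), Thm. (3.8)] -/
theorem pow_mul_real_le_fkLaw_real_subset_inter {q : ℝ} (hq : 1 ≤ q) (Λ : Finset (Site d))
    (W : Sym2 (Site d) → unitInterval) {p : unitInterval} {F : Finset (Sym2 (Site d))} (hF : ∀ e ∈ F, W e = p)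
    (hFΛ : ∀ e ∈ F, ∀ z ∈ e, z ∈ Λ) {C : Set (BondConfig (Site d))} (hC : IsUpperSet C) (hCm : MeasurableSet C) :
    ((p : ℝ) / (p + q * (1 - p))) ^ F.card * (fkLaw Λ W q).real C ≤
      (fkLaw Λ W q).real ({ω | (↑F : Set (Sym2 (Site d))) ⊆ ω} ∩ C) := by
  have hq0 : 0 < q := one_pos.trans_le hq
  haveI : IsProbabilityMeasure (fkLaw Λ W q) := isProbabilityMeasure_fkLaw Λ W hq0
  have hdet : DeterminedBy {ω : BondConfig (Site d) | (↑F : Set (Sym2 (Site d))) ⊆ ω} (↑F : Set (Sym2 (Site d))) := by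
    rw [determinedBy_iff]
    intro ω ω' hω
    simp only [Set.mem_setOf_eq]
    constructor
    · intro h e he
      have := Set.ext_iff.1 hω e
      simp only [Set.mem_inter_iff] at this
      exact (this.1 ⟨h he, he⟩).1
    · intro h e he
      have := Set.ext_iff.1 hω e
      simp only [Set.mem_inter_iff] at this
      exact (this.2 ⟨h he, he⟩).1
  have hAm : MeasurableSet ({ω : BondConfig (Site d) | (↑F : Set (Sym2 (Site d))) ⊆ ω} ∩ C) :=
    hdet.measurableSet_of_finset.inter hCm
  have hπ0 : 0 ≤ (p : ℝ) / (p + q * (1 - p)) := div_nonneg p.2.1 (by nlinarith [p.2.1, p.2.2, hq0])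
  have h := KNFree.ins_tolerance_fkLaw hq Λ W hF hFΛ hAm
  refine le_trans ?_ h
  refine mul_le_mul_of_nonneg_left (measureReal_mono (fun ω hω => ?_) (measure_ne_top _ _)) (pow_nonneg hπ0 _)
  refine ⟨?_, hC Set.subset_union_left hω⟩
  show (↑F : Set (Sym2 (Site d))) ⊆ ω ∪ ↑F
  exact Set.subset_union_right


/-! ### (P1) primitives: placed slab copies inside an arbitrary box, one plate step between two near points -/

/-- A placed slab `σ_π S(L,N) + v` whose centre leaves room lies inside the box `Icc lo hi`
(general-box form of T1s-B's `image_signedPerm_add_subset_box`). [cite: Grimmett2006, §5.7 (proof of Thm. (5.104): the slabs inside a box)] -/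
theorem image_signedPerm_add_subset_Icc (π : Equiv.Perm (Fin d)) (v lo hi : Site d) {L N : ℕ}
    (hv : ∀ j, lo (π j) + (fkSlabHalfWidth d L N j : ℤ) ≤ v (π j) ∧ v (π j) + (fkSlabHalfWidth d L N j : ℤ) ≤ hi (π j)) :
    (fkSlab d L N).image (fun x => Site.signedPerm π 1 x + v) ⊆ Finset.Icc lo hi := by
  intro y hy
  rw [Finset.mem_Icc, Pi.le_def, Pi.le_def]
  have h := fun j => (mem_image_signedPerm_add_iff π v L N y).1 hy j
  constructor
  · intro i
    have h1 := h (π.symm i); have h2 := (hv (π.symm i)).1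
    rw [Equiv.apply_symm_apply] at h1 h2
    linarith [h1.1]
  · intro i
    have h1 := h (π.symm i); have h2 := (hv (π.symm i)).2
    rw [Equiv.apply_symm_apply] at h1 h2
    linarith [h1.2]

/-- A permutation of the coordinates sending the two LONG slab directions (`d-2`, `d-1`) to two prescribed distinct
directions `b₁ ≠ b₂` (`d ≥ 2`). [folklore] -/
theorem exists_perm_long_eq (hd : 2 ≤ d) {b₁ b₂ : Fin d} (hb : b₁ ≠ b₂) :
    ∃ π : Equiv.Perm (Fin d), π ⟨d - 2, by omega⟩ = b₁ ∧ π ⟨d - 1, by omega⟩ = b₂ := by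
  set i₁ : Fin d := ⟨d - 2, by omega⟩ with hi₁
  set i₂ : Fin d := ⟨d - 1, by omega⟩ with hi₂
  have h12 : i₁ ≠ i₂ := by
    intro h; have := congrArg Fin.val h; simp [hi₁, hi₂] at this; omega
  set π₁ : Equiv.Perm (Fin d) := Equiv.swap i₁ b₁ with hπ₁
  have hπ₁i₁ : π₁ i₁ = b₁ := Equiv.swap_apply_left i₁ b₁
  have hne : π₁ i₂ ≠ b₁ := by
    intro h
    have : π₁ i₂ = π₁ i₁ := h.trans hπ₁i₁.symm
    exact h12 (π₁.injective this).symm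
  set π₂ : Equiv.Perm (Fin d) := Equiv.swap (π₁ i₂) b₂ with hπ₂
  refine ⟨π₁.trans π₂, ?_, ?_⟩
  · rw [Equiv.trans_apply, hπ₁i₁, hπ₂]
    exact Equiv.swap_apply_of_ne_of_ne hne.symm hb
  · rw [Equiv.trans_apply, hπ₂]; exact Equiv.swap_apply_left _ _

/-- **One plate step inside a box.** Let `Icc lo hi` have width `≥ 2L+1` in every direction and `≥ 2N+1` in two distinct
directions `b₁ ≠ b₂` (`d ≥ 2`), and let `s, t ∈ Icc lo hi` agree off `{b₁, b₂}` and differ by at most `N` in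
`b₁`, `b₂`. Then some placed copy of `S(L,N)` (long directions ↦ `b₁, b₂`) lies inside the box and contains both points.
[cite: Grimmett2006, §5.7 (proof of Thm. (5.104): slabs placed inside a box)] -/
theorem exists_image_fkSlab_subset_Icc_pair (hd : 2 ≤ d) {L N : ℕ} (lo hi : Site d) {b₁ b₂ : Fin d}
    (hb : b₁ ≠ b₂) (hwide : ∀ i, lo i + 2 * (L : ℤ) ≤ hi i)
    (hwide₁ : lo b₁ + 2 * (N : ℤ) ≤ hi b₁) (hwide₂ : lo b₂ + 2 * (N : ℤ) ≤ hi b₂)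
    {s t : Site d} (hs : s ∈ Finset.Icc lo hi) (ht : t ∈ Finset.Icc lo hi)
    (hst : ∀ i, i ≠ b₁ → i ≠ b₂ → s i = t i) (hst₁ : |s b₁ - t b₁| ≤ N) (hst₂ : |s b₂ - t b₂| ≤ N) :
    ∃ (π : Equiv.Perm (Fin d)) (v : Site d),
      (fkSlab d L N).image (fun x => Site.signedPerm π 1 x + v) ⊆ Finset.Icc lo hi ∧
      s ∈ (fkSlab d L N).image (fun x => Site.signedPerm π 1 x + v) ∧
      t ∈ (fkSlab d L N).image (fun x => Site.signedPerm π 1 x + v) := by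
  obtain ⟨π, hπ₁, hπ₂⟩ := exists_perm_long_eq hd hb
  rw [Finset.mem_Icc, Pi.le_def, Pi.le_def] at hs ht
  -- half-width per ambient coordinate
  have hwj : ∀ j : Fin d, (fkSlabHalfWidth d L N j : ℤ) = if (π j = b₁ ∨ π j = b₂) then (N : ℤ) else (L : ℤ) := by
    intro j
    by_cases hj : d ≤ j.val + 2
    · have : j = ⟨d - 2, by omega⟩ ∨ j = ⟨d - 1, by omega⟩ := by
        rcases Nat.lt_or_ge j.val (d - 1) with h | h
        · left; ext; simp; omega
        · right; ext; simp; omega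
      rcases this with h | h
      · rw [h, hπ₁]
        have h' : d ≤ (d - 2) + 2 := by omega
        simp [fkSlabHalfWidth, h']
      · rw [h, hπ₂]
        have h' : d ≤ (d - 1) + 2 := by omega
        simp [fkSlabHalfWidth, h']
    · have hj1 : π j ≠ b₁ := by
        intro h; rw [← hπ₁] at h; have := congrArg Fin.val (π.injective h); simp at this; omega
      have hj2 : π j ≠ b₂ := by
        intro h; rw [← hπ₂] at h; have := congrArg Fin.val (π.injective h); simp at this; omega
      simp [fkSlabHalfWidth, hj, hj1, hj2]
  -- the centre
  set hw : Fin d → ℤ := fun i => if (i = b₁ ∨ i = b₂) then (N : ℤ) else (L : ℤ) with hhw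
  set v : Site d := fun i => KozmaNitzan.clamp (s i) (lo i + hw i) (hi i - hw i) with hv
  have hwπ : ∀ j, (fkSlabHalfWidth d L N j : ℤ) = hw (π j) := fun j => by rw [hwj j]
  have hroom : ∀ i, lo i + hw i ≤ hi i - hw i := by
    intro i; simp only [hhw]; split_ifs with h
    · rcases h with rfl | rfl <;> linarith
    · linarith [hwide i]
  have hw0 : ∀ i, 0 ≤ hw i := fun i => by simp only [hhw]; split_ifs <;> positivity
  have hvs : ∀ i, |v i - s i| ≤ hw i := fun i =>
    KozmaNitzan.abs_clamp_sub_le (by linarith [(hs.1 i)]) (by linarith [hs.2 i]) (hw0 i) (hroom i)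
  have hvmem : ∀ i, lo i + hw i ≤ v i ∧ v i ≤ hi i - hw i := fun i => KozmaNitzan.clamp_mem (hroom i)
  -- `t` is within `hw` of the centre too
  have hvt : ∀ i, |v i - t i| ≤ hw i := by
    intro i
    by_cases hib : i = b₁ ∨ i = b₂
    · have hN : hw i = N := by simp only [hhw, if_pos hib]
      have hsti : |s i - t i| ≤ N := by rcases hib with rfl | rfl <;> assumption
      rw [hN]
      -- clamp(s_i) : either = s_i, or = lo_i + N (s_i below), or = hi_i - N (s_i above)
      have hvi : v i = KozmaNitzan.clamp (s i) (lo i + N) (hi i - N) := by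
        show KozmaNitzan.clamp (s i) (lo i + hw i) (hi i - hw i) = _; rw [hN]
      have hti := ht.1 i; have hti' := ht.2 i; have hsi := hs.1 i; have hsi' := hs.2 i
      have hroomi := hroom i; rw [hN] at hroomi
      rw [hvi]
      unfold KozmaNitzan.clamp
      rw [abs_le] at hsti ⊢
      constructor <;> omega
    · have : s i = t i := hst i (fun h => hib (Or.inl h)) (fun h => hib (Or.inr h))
      rw [← this]; exact hvs i
  refine ⟨π, v, image_signedPerm_add_subset_Icc π v lo hi (fun j => ?_), ?_, ?_⟩
  · rw [hwπ j]; constructor <;> linarith [(hvmem (π j)).1, (hvmem (π j)).2]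
  · refine (mem_image_signedPerm_add_iff π v L N s).2 fun j => ?_
    rw [hwπ j]; have := hvs (π j); rw [abs_le] at this; constructor <;> linarith [this.1, this.2]
  · refine (mem_image_signedPerm_add_iff π v L N t).2 fun j => ?_
    rw [hwπ j]; have := hvt (π j); rw [abs_le] at this; constructor <;> linarith [this.1, this.2]

/-- **One plate step, probability form**: under `FKSlabPercolation d p q L` (two-point `≥ β` inside every placed copy,
`exists_forall_le_fkLaw_image_fkSlab_real_openConnIn`), two points of a box as in `exists_image_fkSlab_subset_Icc_pair`
are joined INSIDE the box with free-law probability `≥ β` (region monotonicity). The step bound the chain lemma consumes.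
[cite: Grimmett2006, §5.7 eq. (5.102), Thm. (3.21) eq. (3.22), Lemma (4.13)] -/
theorem le_fkLaw_Icc_real_openConnIn_of_near {q : ℝ} (hq : 1 ≤ q) (p : unitInterval) (hd : 2 ≤ d) {L N : ℕ}
    {β : ℝ}
    (hβ : ∀ (g : zdGraph d ≃g zdGraph d) (u z : Site d), u ∈ fkSlab d L N → z ∈ fkSlab d L N →
      β ≤ (fkLaw ((fkSlab d L N).image g) (restrW (↑((fkSlab d L N).image g) : Set (Site d)) (lattW d p)) q).real
        (openConnIn (↑((fkSlab d L N).image g) : Set (Site d)) (g u) (g z)))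
    (lo hi : Site d) {b₁ b₂ : Fin d} (hb : b₁ ≠ b₂) (hwide : ∀ i, lo i + 2 * (L : ℤ) ≤ hi i)
    (hwide₁ : lo b₁ + 2 * (N : ℤ) ≤ hi b₁) (hwide₂ : lo b₂ + 2 * (N : ℤ) ≤ hi b₂)
    {s t : Site d} (hs : s ∈ Finset.Icc lo hi) (ht : t ∈ Finset.Icc lo hi)
    (hst : ∀ i, i ≠ b₁ → i ≠ b₂ → s i = t i) (hst₁ : |s b₁ - t b₁| ≤ N) (hst₂ : |s b₂ - t b₂| ≤ N) :
    β ≤ (fkLaw (Finset.Icc lo hi) (restrW (↑(Finset.Icc lo hi) : Set (Site d)) (lattW d p)) q).real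
      (openConnIn (↑(Finset.Icc lo hi) : Set (Site d)) s t) := by
  have hq0 : 0 < q := one_pos.trans_le hq
  haveI : IsProbabilityMeasure
      (fkLaw (Finset.Icc lo hi) (restrW (↑(Finset.Icc lo hi) : Set (Site d)) (lattW d p)) q) :=
    isProbabilityMeasure_fkLaw _ _ hq0
  obtain ⟨π, v, hsub, hsmem, htmem⟩ :=
    exists_image_fkSlab_subset_Icc_pair hd lo hi hb hwide hwide₁ hwide₂ hs ht hst hst₁ hst₂
  set g : zdGraph d ≃g zdGraph d := (zdSignedPermIso π 1).trans (zdShiftIso v) with hg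
  have hgimg : (fkSlab d L N).image g = (fkSlab d L N).image (fun x => Site.signedPerm π 1 x + v) := rfl
  obtain ⟨u, hu, hsu⟩ := Finset.mem_image.1 hsmem
  obtain ⟨z, hz, htz⟩ := Finset.mem_image.1 htmem
  have hgu : g u = s := hsu
  have hgz : g z = t := htz
  have h1 := hβ g u z hu hz
  rw [hgu, hgz, hgimg] at h1
  refine h1.trans ?_
  refine (fkLaw_restrW_real_mono_region hq (lattW d p) hsub (isUpperSet_openConnIn _ _ _)
    (measurableSet_openConnIn_of_countable _ _ _)).trans ?_
  exact measureReal_mono (openConnIn_mono (Finset.coe_subset.2 hsub) _ _) (measure_ne_top _ _)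

/-! ### Straight lanes inside a fat box: `k` plate steps along one coordinate -/

/-- Composition of two connections inside a region (FKG at `q ≥ 1` + transitivity):
`β₁ ≤ φ(s ↔ w in S)`, `β₂ ≤ φ(w ↔ t in S)`, `0 ≤ β₁` ⇒ `β₁ β₂ ≤ φ(s ↔ t in S)`. [cite: Grimmett2006, Thm. (3.8)] -/
theorem mul_le_fkLaw_real_openConnIn_trans (Λ : Finset (Site d)) (W : Sym2 (Site d) → unitInterval) {q : ℝ}
    (hq : 1 ≤ q) (S : Set (Site d)) (s w t : Site d) {β₁ β₂ : ℝ} (h0 : 0 ≤ β₁)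
    (h1 : β₁ ≤ (fkLaw Λ W q).real (openConnIn S s w)) (h2 : β₂ ≤ (fkLaw Λ W q).real (openConnIn S w t)) :
    β₁ * β₂ ≤ (fkLaw Λ W q).real (openConnIn S s t) := by
  have hq0 : 0 < q := one_pos.trans_le hq
  haveI : IsProbabilityMeasure (fkLaw Λ W q) := isProbabilityMeasure_fkLaw Λ W hq0
  rcases lt_or_ge β₂ 0 with hb2 | hb2
  · exact le_trans (mul_nonpos_iff.2 (Or.inl ⟨h0, hb2.le⟩)) measureReal_nonneg
  calc β₁ * β₂ ≤ (fkLaw Λ W q).real (openConnIn S s w) * (fkLaw Λ W q).real (openConnIn S w t) :=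
        mul_le_mul h1 h2 hb2 measureReal_nonneg
    _ ≤ (fkLaw Λ W q).real (openConnIn S s w ∩ openConnIn S w t) := by
        rw [fkLaw_real_apply Λ W q (measurableSet_openConnIn_of_countable _ _ _),
          fkLaw_real_apply Λ W q (measurableSet_openConnIn_of_countable _ _ _),
          fkLaw_real_apply Λ W q ((measurableSet_openConnIn_of_countable _ _ _).inter
            (measurableSet_openConnIn_of_countable _ _ _)), Set.preimage_inter]
        exact rcMeasureW_fkg _ hq ∅ (isUpperSet_preimage_liftEdges Λ (isUpperSet_openConnIn _ _ _))
          (isUpperSet_preimage_liftEdges Λ (isUpperSet_openConnIn _ _ _))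
    _ ≤ (fkLaw Λ W q).real (openConnIn S s t) := by
        refine measureReal_mono (fun ω hω => ?_) (measure_ne_top _ _)
        obtain ⟨⟨h0', _, hr⟩, ⟨_, h1', hr'⟩⟩ := hω
        exact ⟨h0', h1', hr.trans hr'⟩

/-- **A straight lane of `k` plate steps inside a fat box.** Box `Icc lo hi` of width `≥ 2L+1` everywhere and `≥ 2N+1`
in two distinct directions `b ≠ b'` (`d ≥ 2`); `s, t` in the box agreeing off `b` with `|s_b - t_b| ≤ k·N`.
Then `φ^free_box(s ↔ t in the box) ≥ β^k`, `β ≥ 0` the placed-copy two-point bound (`Π(p,L)` ⇒ `β = α²`).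
The building block of the lanes of the slab Step IV. [cite: Grimmett2006, §5.7 eq. (5.102), Thm. (3.8), eq. (3.22); KozmaNitzan2024, §4 Lemma 10 Step IV (pp. 19–21)] -/
theorem pow_le_fkLaw_Icc_real_openConnIn_line {q : ℝ} (hq : 1 ≤ q) (p : unitInterval) (hd : 2 ≤ d) {L N : ℕ}
    {β : ℝ} (hβ0 : 0 ≤ β)
    (hβ : ∀ (g : zdGraph d ≃g zdGraph d) (u z : Site d), u ∈ fkSlab d L N → z ∈ fkSlab d L N →
      β ≤ (fkLaw ((fkSlab d L N).image g) (restrW (↑((fkSlab d L N).image g) : Set (Site d)) (lattW d p)) q).real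
        (openConnIn (↑((fkSlab d L N).image g) : Set (Site d)) (g u) (g z)))
    (lo hi : Site d) {b b' : Fin d} (hbb : b ≠ b') (hwide : ∀ i, lo i + 2 * (L : ℤ) ≤ hi i)
    (hwideb : lo b + 2 * (N : ℤ) ≤ hi b) (hwideb' : lo b' + 2 * (N : ℤ) ≤ hi b')
    (k : ℕ) {s t : Site d} (hs : s ∈ Finset.Icc lo hi) (ht : t ∈ Finset.Icc lo hi)
    (hst : ∀ i, i ≠ b → s i = t i) (hk : |s b - t b| ≤ (k : ℤ) * N) :
    β ^ k ≤ (fkLaw (Finset.Icc lo hi) (restrW (↑(Finset.Icc lo hi) : Set (Site d)) (lattW d p)) q).real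
      (openConnIn (↑(Finset.Icc lo hi) : Set (Site d)) s t) := by
  have hq0 : 0 < q := one_pos.trans_le hq
  haveI : IsProbabilityMeasure
      (fkLaw (Finset.Icc lo hi) (restrW (↑(Finset.Icc lo hi) : Set (Site d)) (lattW d p)) q) :=
    isProbabilityMeasure_fkLaw _ _ hq0
  have htI : (∀ i, lo i ≤ t i) ∧ ∀ i, t i ≤ hi i := by
    have := ht; rw [Finset.mem_Icc, Pi.le_def, Pi.le_def] at this; exact this
  induction k generalizing s with
  | zero =>
    have hst' : s = t := by
      funext i
      by_cases hib : i = b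
      · subst hib
        have h0 : |s i - t i| ≤ 0 := by simpa using hk
        have := abs_nonpos_iff.1 h0; linarith
      · exact hst i hib
    subst hst'
    have hsB : s ∈ (↑(Finset.Icc lo hi) : Set (Site d)) := Finset.mem_coe.2 hs
    have huniv : (openConnIn (↑(Finset.Icc lo hi) : Set (Site d)) s s : Set (BondConfig (Site d))) = Set.univ := by
      ext ω; simp only [Set.mem_univ, iff_true]; exact ⟨hsB, hsB, SimpleGraph.Reachable.refl _⟩
    rw [pow_zero, huniv, probReal_univ]
  | succ k ih =>
    have hsI : (∀ i, lo i ≤ s i) ∧ ∀ i, s i ≤ hi i := by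
      have := hs; rw [Finset.mem_Icc, Pi.le_def, Pi.le_def] at this; exact this
    -- the intermediate point `w`: displacement clamped to `[-N, N]` along `b`
    set wb : ℤ := s b + KozmaNitzan.clamp (t b - s b) (-(N : ℤ)) N with hwb
    set w : Site d := Function.update s b wb with hw
    have hwb_b : w b = wb := by simp [hw]
    have hw_ne : ∀ i, i ≠ b → w i = s i := fun i hi => by simp [hw, hi]
    set KN : ℤ := (k : ℤ) * N with hKN
    have hKN0 : 0 ≤ KN := by rw [hKN]; positivity
    have hN0 : (0 : ℤ) ≤ N := by positivity
    have hkN : -(KN + N) ≤ s b - t b ∧ s b - t b ≤ KN + N := by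
      have : ((k : ℤ) + 1 : ℤ) * N = KN + N := by rw [hKN]; ring
      have h' : |s b - t b| ≤ KN + N := by rw [← this]; push_cast at hk; exact hk
      exact abs_le.1 h'
    have h1a : |s b - wb| ≤ N := by
      rw [abs_le, hwb]; unfold KozmaNitzan.clamp; constructor <;> omega
    have h1b : |wb - t b| ≤ KN := by
      rw [abs_le, hwb]; unfold KozmaNitzan.clamp; constructor <;> omega
    have h1c : min (s b) (t b) ≤ wb := by rw [hwb]; unfold KozmaNitzan.clamp; omega
    have h1d : wb ≤ max (s b) (t b) := by rw [hwb]; unfold KozmaNitzan.clamp; omega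
    have hwB : w ∈ Finset.Icc lo hi := by
      rw [Finset.mem_Icc, Pi.le_def, Pi.le_def]
      constructor
      · intro i
        by_cases hib : i = b
        · subst hib; rw [hwb_b]; exact le_trans (le_min (hsI.1 i) (htI.1 i)) h1c
        · rw [hw_ne i hib]; exact hsI.1 i
      · intro i
        by_cases hib : i = b
        · subst hib; rw [hwb_b]; exact le_trans h1d (max_le (hsI.2 i) (htI.2 i))
        · rw [hw_ne i hib]; exact hsI.2 i
    -- one plate step `s → w`
    have hstep : β ≤ (fkLaw (Finset.Icc lo hi) (restrW (↑(Finset.Icc lo hi) : Set (Site d)) (lattW d p)) q).real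
        (openConnIn (↑(Finset.Icc lo hi) : Set (Site d)) s w) := by
      refine le_fkLaw_Icc_real_openConnIn_of_near hq p hd hβ lo hi hbb hwide hwideb hwideb' hs hwB
        (fun i hi _ => (hw_ne i hi).symm) ?_ ?_
      · rw [hwb_b]; exact h1a
      · rw [hw_ne b' hbb.symm, sub_self, abs_zero]; positivity
    -- the remaining `k` steps `w → t`
    have hrest : β ^ k ≤ (fkLaw (Finset.Icc lo hi) (restrW (↑(Finset.Icc lo hi) : Set (Site d)) (lattW d p)) q).real
        (openConnIn (↑(Finset.Icc lo hi) : Set (Site d)) w t) := by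
      refine ih hwB (fun i hi => by rw [hw_ne i hi]; exact hst i hi) ?_
      rw [hwb_b]; exact h1b
    calc β ^ (k + 1) = β * β ^ k := pow_succ' β k
      _ ≤ _ := mul_le_fkLaw_real_openConnIn_trans (Finset.Icc lo hi) _ hq _ s w t hβ0 hstep hrest

end Summit.CriticalPhenomena.PercolationContinuityZ3.Theorems.FK

end
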